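import Summits.Ventures.PackingBounds.Energy.TangentLineUniversal

/-!
# Coulomb energy: the tangent-line (Jensen) bound in every dimension — sharp for regular simplices

Framing: lottery ticket; floor = certified bounds/negative ranges. Venture `PackingBounds` (cell
`pub-packcert`, seat `pub-packcert-energy`), energy-minimisation family, **universal + control**.

**Theorem.** For `n ≥ 3`, `N ≥ 2` and every configuration `C` of `N` unit vectors of `ℝⁿ`,
`Σ_{x ≠ y ∈ C} |x - y|⁻¹ ≥ N (N - 1) / √(2N/(N-1))  ( = N (N-1) √((N-1)/(2N)) )`,
with equality for the regular simplex when `N ≤ n + 1`: this is the universally optimal simplex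
row of Cohn–Kumar 2007, Table 1, for the Coulomb potential, and for `n = 3`, `N = 4` the Thomson
problem for four points (regular tetrahedron, energy `12 √(3/8) = 7.348…`, i.e. `3.674…` per pair).
Proof: `tangent_energy_ge` with `a(t) = (2 - 2t)^(-1/2)`, `t₀ = -1/(N-1)`, `u₀ = 2 - 2t₀`,
`r₀ = √u₀`, slope `m = r₀⁻³`; the supporting-line inequality is the convexity identity
`1/r - 1/r₀ - (r₀² - r²)/(2 r₀³) = (r₀ - r)² (2 r₀ + r) / (2 r r₀³) ≥ 0` with `r = √(2 - 2t)`.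

## References
* H. Cohn, A. Kumar, J. Amer. Math. Soc. 20 (2007) 99–148, Thm. 1.2, Table 1. [`CohnKumar2006`]
-/

namespace Summit.Ventures.PackingBounds.Energy

open Finset Literature.Analysis.SpecialFunctions Literature.Geometry.DiscreteGeometry

open scoped Classical in
/-- **Coulomb tangent-line bound, all dimensions** (sharp for regular simplices `N ≤ n+1`; Thomson
`N = 4` for `n = 3`): for `n ≥ 3`, `N ≥ 2`, every `N` unit vectors of `ℝⁿ` have
`Σ_{x ≠ y} |x - y|⁻¹ ≥ N (N-1) (√(2N/(N-1)))⁻¹`. [cite: CohnKumar2006, Theorem 1.2 and Proposition 4.1] -/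
theorem coulomb_tangent_energy_ge {n : ℕ} (hn : 3 ≤ n) (N : ℕ) (hN2 : 2 ≤ N)
    (C : Finset (EuclideanSpace ℝ (Fin n))) (h1 : ∀ x ∈ C, ‖x‖ = 1) (hN : C.card = N) :
    (N : ℝ) * ((N : ℝ) - 1) * (Real.sqrt (2 * N / ((N : ℝ) - 1)))⁻¹ ≤
      ∑ x ∈ C, ∑ y ∈ C.erase x, ‖x - y‖⁻¹ := by
  have hN2' : (2 : ℝ) ≤ N := by exact_mod_cast hN2
  have hN1 : (0 : ℝ) < (N : ℝ) - 1 := by linarith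
  have hu₀eq : (2 : ℝ) - 2 * (-1 / ((N : ℝ) - 1)) = 2 * N / ((N : ℝ) - 1) := by
    field_simp; ring
  set u₀ : ℝ := 2 * N / ((N : ℝ) - 1) with hu₀
  have hu₀pos : 0 < u₀ := by rw [hu₀]; positivity
  set r₀ : ℝ := Real.sqrt u₀ with hr₀
  have hr₀pos : 0 < r₀ := Real.sqrt_pos.mpr hu₀pos
  have hr₀sq : r₀ ^ 2 = u₀ := Real.sq_sqrt hu₀pos.le
  set m : ℝ := (r₀ ^ 3)⁻¹ with hm
  have hmnn : 0 ≤ m := by rw [hm]; positivity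
  have key := tangent_energy_ge hn N hN2 (fun t : ℝ => (Real.sqrt (2 - 2 * t))⁻¹) m hmnn ?_ ?_
    C h1 hN
  · have hconv : ∑ x ∈ C, ∑ y ∈ C.erase x,
        (fun t : ℝ => (Real.sqrt (2 - 2 * t))⁻¹) (inner ℝ x y) =
        ∑ x ∈ C, ∑ y ∈ C.erase x, ‖x - y‖⁻¹ := by
      refine Finset.sum_congr rfl fun x hx => Finset.sum_congr rfl fun y hy => ?_
      have hyC : y ∈ C := Finset.mem_of_mem_erase hy
      have hsq : ‖x - y‖ ^ 2 = 2 - 2 * inner ℝ x y := by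
        rw [@norm_sub_sq_real, h1 x hx, h1 y hyC]; ring
      show (Real.sqrt (2 - 2 * inner ℝ x y))⁻¹ = ‖x - y‖⁻¹
      rw [← hsq, Real.sqrt_sq (norm_nonneg _)]
    rw [hconv, hu₀eq] at key
    exact key
  · -- supporting line (convexity of u ↦ u^(-1/2))
    intro t ht1 ht2
    show (Real.sqrt (2 - 2 * (-1 / ((N : ℝ) - 1))))⁻¹ + m * (t + 1 / ((N : ℝ) - 1)) ≤
      (Real.sqrt (2 - 2 * t))⁻¹
    rw [hu₀eq]
    have hpos : (0 : ℝ) < 2 - 2 * t := by linarith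
    set r : ℝ := Real.sqrt (2 - 2 * t) with hr
    have hrpos : 0 < r := Real.sqrt_pos.mpr hpos
    have hrsq : r ^ 2 = 2 - 2 * t := Real.sq_sqrt hpos.le
    have ht0 : t + 1 / ((N : ℝ) - 1) = (r₀ ^ 2 - r ^ 2) / 2 := by
      rw [hr₀sq, hrsq, hu₀]; field_simp; ring
    rw [ht0, hm]
    change r₀⁻¹ + (r₀ ^ 3)⁻¹ * ((r₀ ^ 2 - r ^ 2) / 2) ≤ r⁻¹
    rw [show r⁻¹ = 1 / r from inv_eq_one_div _, le_div_iff₀ hrpos]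
    have hr0ne : r₀ ≠ 0 := hr₀pos.ne'
    have hexp : (r₀⁻¹ + (r₀ ^ 3)⁻¹ * ((r₀ ^ 2 - r ^ 2) / 2)) * r =
        1 - (r₀ - r) ^ 2 * (2 * r₀ + r) / (2 * r₀ ^ 3) := by
      field_simp
      ring
    rw [hexp]
    have hnn : 0 ≤ (r₀ - r) ^ 2 * (2 * r₀ + r) / (2 * r₀ ^ 3) := by positivity
    linarith
  · show (0 : ℝ) ≤ (Real.sqrt (2 - 2 * (-1 / ((N : ℝ) - 1))))⁻¹ + m / ((N : ℝ) - 1)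
    positivity

end Summit.Ventures.PackingBounds.Energy
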